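import Summits.QuantumFields.BalabanUV.Beta.GAN24.Entry110GDivCubic

/-!
# Row G-an2-4 ∕ (CONV-C) — the SECOND-ORDER sup letters, CARRIER TRANSPORT (S2-e): second differences `∇_μ∇_νΔ_1⁻¹` and the
# operator form `Δ_1⁻¹∇_μ^*∇_ν^*` at `U = 1`, per-block row sums on Bałaban's fine torus FROM per-cube rows on the NE3 flat carrier —
# instance-level and allowance-agnostic

NOT IN PRINT; OUR BOOKKEEPING.  Cell `pub-balaban`, G-an2-4 crux team (coordinator ruling e34b3e0c (2)), leaf seat
`b2b-balaban-gan24-formalise-leaf-04` (gen 47), item «S2-TRANSPORT∕END» (journal `CLAIMS.log` l.28813) — the transport∕packaging half of the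
second-order sup letters the road-P2 owner `b2b-balaban-gan24-p2` (gen 29, journal l.28555) announced as its refined request («two NEW
second-order sup entries — `G∇*∇*` row sums `‖G′∂′ᴴ∂′ᴴ‖_{∞→∞}` … with a `log n` allowance — and pure second differences»); the ANALYTIC
half (heat-kernel second differences, the located `log`, the resolvent identity differenced twice) is the flat suppliers'
(`…-gan24-formalise-leaf-03` l.28719 ∕ `…-leaf-06` l.28735), the LETTERS are `…-leaf-01`'s (l.28781).  This file is the second-order twin
of NE2-leaf-05's `T4Continuum/Support/GradientRowSumTransport` (first differences) and of §1–§2 of `GAN24/Entry110GDivCubic` (first column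
differences); no Support leaf, no new object, no Literature fact, 0 `def`, 0 `def … : Prop`, 0 sorry.

WHAT IS PROVED (kernel; `G = Δ_1⁻¹ = (B5DeltaA169.DeltaA n M 1)⁻¹`, `∇_ν = B5Prop11Plancherel.fdiff (fine n M) n ν`, `∇_ν^* = (fdiff …)ᴴ`;
NE3 carrier `TPt (d+1) (N·L^k) × Fin (d+1)`, `gFlat j = n²·Re Δ_1⁻¹ ∘ eF`, `n = side k L j`, `M ≡ Mlev d k N L j`):
 * §1 DICTIONARY — `fdiff_fdiff_mul_apply` ∕ `mul_fdiffH_fdiffH_apply` (entries of `∇_μ·∇_ν·A` and `A·∇_μ^*·∇_ν^*`: the four-point second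
   differences of the row ∕ column site, weight `n²`), `norm_fdiff_fdiff_DeltaA_inv_apply` ∕ `norm_DeltaA_inv_fdiffH_fdiffH_apply`
   (realness of `Δ_a⁻¹`, pv15's `B5RealFields.isReal_DeltaA_inv`), and the two identities WITH NO POWER OF `n`:
   **`abs_rowDiff_rowDiff_gFlat_eq`**: `|rowDiff μ (rowDiff ν (gFlat j)) p q| = ‖(∇_μ·∇_ν·Δ_1⁻¹)((eF p₁,p₂),(eF q₁,q₂))‖` and
   **`abs_gFlat_mul_colDiff_colDiff_eq`**: `|(gFlat j·colDiff μ·colDiff ν)(p,q)| = ‖(Δ_1⁻¹·∇_μ^*·∇_ν^*)((eF p₁,p₂),(eF q₁,q₂))‖`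
   (`gFlat` carries `n²`, and so do two lattice differences);
 * §2 TRANSPORT, INSTANCE-LEVEL, ALLOWANCE-AGNOSTIC — **`block_row_sum_fdiff_fdiff_inv_le`**: for FIXED `(k, N, L, j, μ, ν)` and ANY reals
   `A`, `δ ≥ 0`, a per-cube row bound `∀ p y₁, Σ_{q : cubeI j q = y₁} |rowDiff μ (rowDiff ν (gFlat j)) p q| ≤ A·e^{−δ·nbd_j(cubeI j p, y₁)}`
   on the flat carrier gives, for every row `i` and block `y′` of `Tor (fine n M) × Fin (d+1)`,
   `Σ_{x′ : blockOf x′ = y′} ‖(∇_μ·∇_ν·Δ_1⁻¹)(i,x′)‖ ≤ A·e^{−δ·|blockOf i − y′|_{T₁,∞}}` (`GradientRowSumTransport.blockOf_eF`,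
   `torusSupNorm_rep_sub_rep_le_nbd` BY NAME); **`block_row_sum_inv_fdiffH_fdiffH_le`**: the same from per-cube rows of the OPERATOR form
   `gFlat j·colDiff μ·colDiff ν` to `Σ_{x′ : blockOf x′ = y′} ‖(Δ_1⁻¹·∇_μ^*·∇_ν^*)(i,x′)‖`.  The allowance (`A = B₂·(1 + log L^j)`, or
   `B₂·(L^j)^ε`, or whatever the requester rules) is plugged into `A`; the transport never sees it;
 * §3 CUBIC COROLLARIES, CONDITIONAL ON THE FLAT ENDs' ANNOUNCED SHAPE — **`block_row_sum_fdiff_fdiff_inv_le_cubic_of_flat`** ∕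
   **`block_row_sum_inv_fdiffH_fdiffH_le_cubic_of_flat`**: IF the flat second-order rows hold in the shape the suppliers announced
   (`∃ B₂ δ > 0, ∀ k N L, j ≤ k, μ ν p y₁, Σ ≤ B₂·(1 + Real.log ((L:ℝ)^j))·e^{−δ·nbd}` — leaf-03's `cubeSum_rowDiff_rowDiff_gFlat_le`, leaf-06's
   `cubeSum_rowDiff2_gFlat_le`; resp. the operator-form rows), THEN for EVERY `n ≥ 1`, EVERY cubic unit torus `Π ℤ∕N₀`, all `μ ν i y′`:
   `Σ_{x′ : blockOf x′ = y′} ‖(∇_μ·∇_ν·Δ_1⁻¹)(i,x′)‖ ≤ B₂·(1 + log n)·e^{−δ·|blockOf i − y′|_{T₁,∞}}` (witness `(k,N,L,j) = (1,N₀,n,1)`, NE2-leaf-05's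
   §5 `subst` pattern) — the hypothesis is DISCHARGED BY NAME the day a flat END lands; nothing here changes.

HONEST SCOPE.  [folklore] bookkeeping between the cell's typed `U = 1` objects; 0 estimates: every analytic statement enters as a
HYPOTHESIS (`hrow`, `hcol`, `hflat`), proved by nobody in this file (and, at this file's writing, by nobody in the tree).  `a = 1`;
cubic tori in §3 (the NE3 carrier has one period for all directions); the printed [B5] Prop. 1.2 second-order entries (1.112)–(1.113)
(`Balaban1984PropagatorsI` pp. 35–36) are HÖLDER-norm statements WITHOUT a log — a TEXT LOCATION only; the `ℓ^∞ → ℓ^∞` form with an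
allowance is OURS.  NOT (CONV-C), NEVER «G-an2-4 closed», NOT NE2 ∕ NE3, NOT D1, NOT BetaPertH, NOT the continuum limit, NOT Clay.
HONEST DEPENDENCY: continuum YM on T⁴ ⇐ BetaPertH ∧ nine spine estimates (0/9 proved); BetaPertH ⇐ (D1) ∧ (D4) ∧ CAP+tail; G-an2-4
gates asym, D1 and NE2/3/4.
-/

noncomputable section

open scoped BigOperators ComplexConjugate Matrix
open Finset

namespace Summit.QuantumFields.BalabanUV.Beta.GAN24.SndDiffRowSumTransport

open Literature.MathematicalPhysics.QuantumFieldTheory.Balaban1983to89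
open Literature.MathematicalPhysics.QuantumFieldTheory.Balaban1983to89.TreeLengthTorus (TPt)
open B5Prop11Plancherel (Tor fine unitVec shiftM fdiff)
open B5Block118 (bpt)
open B5Blocks16 (blockOf blockOf_bpt)
open B6LowerBound2153Torus (toT rep)
open B5DeltaA169 (DeltaA)
open B5RealFields (isReal_DeltaA_inv)
open B4TorusKernel.MultiPeriod (torusSupNorm torusSupNorm_nonneg)
open Summit.QuantumFields.BalabanUV.T4Continuum
open SliceTorusBlocks SliceTorusTower SliceCovariantTower SliceFlatPropagator SliceFlatFreeResolvent SliceFlatGradientPrep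
open SliceFlatGradient GradientRowSumTransport Entry110GDivCubic

variable {d : ℕ}

/-! ## §1 Dictionary: entries of `∇_μ·∇_ν·A` and `A·∇_μ^*·∇_ν^*`; NE3's double differences of `gFlat` ARE pv15's, with no power of `n` -/

section Dictionary

variable (Nf : Fin d → ℕ) [∀ μ, NeZero (Nf μ)]

/-- **`(∇_μ·∇_ν·A)(i,j) = c²·(A((i₁+e_μ+e_ν,i₂),j) − A((i₁+e_μ,i₂),j) − A((i₁+e_ν,i₂),j) + A(i,j))`**: two forward differences of the
ROW site. [folklore] -/
theorem fdiff_fdiff_mul_apply {ι : Type*} (c : ℂ) (μ ν : Fin d) (A : Matrix (Tor Nf × Fin d) ι ℂ) (i : Tor Nf × Fin d) (j : ι) :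
    (fdiff Nf c μ * fdiff Nf c ν * A) i j
      = c * c * (A (i.1 + unitVec Nf μ + unitVec Nf ν, i.2) j - A (i.1 + unitVec Nf μ, i.2) j
          - A (i.1 + unitVec Nf ν, i.2) j + A i j) := by
  rw [Matrix.mul_assoc, fdiff_mul_apply, fdiff_mul_apply, fdiff_mul_apply]
  ring

/-- **`(A·∇_μ^*·∇_ν^*)(i,j) = c̄²·(A(i,(j₁+e_ν+e_μ,j₂)) − A(i,(j₁+e_ν,j₂)) − A(i,(j₁+e_μ,j₂)) + A(i,j))`**: two forward differences of
the COLUMN site. [folklore] -/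
theorem mul_fdiffH_fdiffH_apply {ι : Type*} (c : ℂ) (μ ν : Fin d) (A : Matrix ι (Tor Nf × Fin d) ℂ) (i : ι) (j : Tor Nf × Fin d) :
    (A * (fdiff Nf c μ)ᴴ * (fdiff Nf c ν)ᴴ) i j
      = starRingEnd ℂ c * starRingEnd ℂ c * (A i (j.1 + unitVec Nf ν + unitVec Nf μ, j.2) - A i (j.1 + unitVec Nf ν, j.2)
          - A i (j.1 + unitVec Nf μ, j.2) + A i j) := by
  rw [mul_fdiff_conjTranspose_apply, mul_fdiff_conjTranspose_apply, mul_fdiff_conjTranspose_apply]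
  ring

variable (n : ℕ) [NeZero n] (M : Fin d → ℕ) [∀ μ, NeZero (M μ)]

/-- the entries of `∇_μ·∇_ν·Δ_a⁻¹` are `n²·|second difference of Re G in the row site|` (`G = Δ_a⁻¹` is REAL, pv15's
`B5RealFields.isReal_DeltaA_inv`). [folklore] -/
theorem norm_fdiff_fdiff_DeltaA_inv_apply (a : ℝ) (μ ν : Fin d) (i j : Tor (fine n M) × Fin d) :
    ‖(fdiff (fine n M) (n : ℂ) μ * fdiff (fine n M) (n : ℂ) ν * (DeltaA n M a)⁻¹) i j‖
      = (n : ℝ) ^ 2 * |((DeltaA n M a)⁻¹ (i.1 + unitVec (fine n M) μ + unitVec (fine n M) ν, i.2) j).re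
          - ((DeltaA n M a)⁻¹ (i.1 + unitVec (fine n M) μ, i.2) j).re
          - ((DeltaA n M a)⁻¹ (i.1 + unitVec (fine n M) ν, i.2) j).re + ((DeltaA n M a)⁻¹ i j).re| := by
  rw [fdiff_fdiff_mul_apply]
  set G := (DeltaA n M a)⁻¹ with hG
  have h1 := (isReal_DeltaA_inv n M a).im_eq_zero (i.1 + unitVec (fine n M) μ + unitVec (fine n M) ν, i.2) j
  have h2 := (isReal_DeltaA_inv n M a).im_eq_zero (i.1 + unitVec (fine n M) μ, i.2) j
  have h3 := (isReal_DeltaA_inv n M a).im_eq_zero (i.1 + unitVec (fine n M) ν, i.2) j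
  have h4 := (isReal_DeltaA_inv n M a).im_eq_zero i j
  rw [← hG] at h1 h2 h3 h4
  have e : G (i.1 + unitVec (fine n M) μ + unitVec (fine n M) ν, i.2) j - G (i.1 + unitVec (fine n M) μ, i.2) j
        - G (i.1 + unitVec (fine n M) ν, i.2) j + G i j
      = (((G (i.1 + unitVec (fine n M) μ + unitVec (fine n M) ν, i.2) j).re - (G (i.1 + unitVec (fine n M) μ, i.2) j).re
          - (G (i.1 + unitVec (fine n M) ν, i.2) j).re + (G i j).re : ℝ) : ℂ) := by
    apply Complex.ext
    · simp
    · simp [h1, h2, h3, h4]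
  rw [e, norm_mul, norm_mul, Complex.norm_natCast, Complex.norm_real, Real.norm_eq_abs]
  ring

/-- the entries of `Δ_a⁻¹·∇_μ^*·∇_ν^*` are `n²·|second difference of Re G in the column site|`. [folklore] -/
theorem norm_DeltaA_inv_fdiffH_fdiffH_apply (a : ℝ) (μ ν : Fin d) (i j : Tor (fine n M) × Fin d) :
    ‖((DeltaA n M a)⁻¹ * (fdiff (fine n M) (n : ℂ) μ)ᴴ * (fdiff (fine n M) (n : ℂ) ν)ᴴ) i j‖
      = (n : ℝ) ^ 2 * |((DeltaA n M a)⁻¹ i (j.1 + unitVec (fine n M) ν + unitVec (fine n M) μ, j.2)).re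
          - ((DeltaA n M a)⁻¹ i (j.1 + unitVec (fine n M) ν, j.2)).re
          - ((DeltaA n M a)⁻¹ i (j.1 + unitVec (fine n M) μ, j.2)).re + ((DeltaA n M a)⁻¹ i j).re| := by
  rw [mul_fdiffH_fdiffH_apply, Complex.conj_natCast]
  set G := (DeltaA n M a)⁻¹ with hG
  have h1 := (isReal_DeltaA_inv n M a).im_eq_zero i (j.1 + unitVec (fine n M) ν + unitVec (fine n M) μ, j.2)
  have h2 := (isReal_DeltaA_inv n M a).im_eq_zero i (j.1 + unitVec (fine n M) ν, j.2)
  have h3 := (isReal_DeltaA_inv n M a).im_eq_zero i (j.1 + unitVec (fine n M) μ, j.2)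
  have h4 := (isReal_DeltaA_inv n M a).im_eq_zero i j
  rw [← hG] at h1 h2 h3 h4
  have e : G i (j.1 + unitVec (fine n M) ν + unitVec (fine n M) μ, j.2) - G i (j.1 + unitVec (fine n M) ν, j.2)
        - G i (j.1 + unitVec (fine n M) μ, j.2) + G i j
      = (((G i (j.1 + unitVec (fine n M) ν + unitVec (fine n M) μ, j.2)).re - (G i (j.1 + unitVec (fine n M) ν, j.2)).re
          - (G i (j.1 + unitVec (fine n M) μ, j.2)).re + (G i j).re : ℝ) : ℂ) := by
    apply Complex.ext
    · simp
    · simp [h1, h2, h3, h4]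
  rw [e, norm_mul, norm_mul, Complex.norm_natCast, Complex.norm_real, Real.norm_eq_abs]
  ring

end Dictionary

section Flat

variable (d k N L : ℕ) [NeZero N] [NeZero L]

/-- **NE3's DOUBLE ROW DIFFERENCE OF `gFlat j` IS pv15's `∇_μ·∇_ν·Δ_1⁻¹` READ THROUGH `eF`, WITH NO POWER OF `n`**:
`|rowDiff μ (rowDiff ν (gFlat j)) p q| = ‖(∇_μ·∇_ν·(DeltaA (side k L j) (Mlev d k N L j) 1)⁻¹)((eF p₁,p₂),(eF q₁,q₂))‖`
(`gFlat = n²·Re Δ_1⁻¹∘eF` and `∇_μ∇_ν` carries `n²`). [folklore] -/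
theorem abs_rowDiff_rowDiff_gFlat_eq (j : ℕ) (μ ν : Fin (d + 1)) (p q : TPt (d + 1) (N * L ^ k) × Fin (d + 1)) :
    |rowDiff d k N L μ (rowDiff d k N L ν (gFlat d k N L j)) p q|
      = ‖(fdiff (fine (side k L j) (Mlev d k N L j)) (side k L j : ℂ) μ
          * fdiff (fine (side k L j) (Mlev d k N L j)) (side k L j : ℂ) ν
          * (DeltaA (side k L j) (Mlev d k N L j) 1)⁻¹) (eF d k N L j p.1, p.2) (eF d k N L j q.1, q.2)‖ := by
  rw [norm_fdiff_fdiff_DeltaA_inv_apply]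
  simp only [rowDiff, gFlat]
  simp only [SliceFlatStencil.eF_add, SliceFlatStencil.eF_single]
  have hs : (0 : ℝ) ≤ (side k L j : ℝ) ^ 2 := by positivity
  rw [← abs_of_nonneg hs, ← abs_mul, abs_of_nonneg hs]
  congr 1
  ring

/-- **NE3's DOUBLE COLUMN DIFFERENCE OF `gFlat j` IS pv15's OPERATOR FORM `Δ_1⁻¹·∇_μ^*·∇_ν^*` READ THROUGH `eF`, WITH NO POWER OF `n`**:
`|(gFlat j·colDiff μ·colDiff ν)(p,q)| = ‖((DeltaA (side k L j) (Mlev d k N L j) 1)⁻¹·∇_μᴴ·∇_νᴴ)((eF p₁,p₂),(eF q₁,q₂))‖`. [folklore] -/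
theorem abs_gFlat_mul_colDiff_colDiff_eq (j : ℕ) (μ ν : Fin (d + 1)) (p q : TPt (d + 1) (N * L ^ k) × Fin (d + 1)) :
    |(gFlat d k N L j * colDiff d k N L μ * colDiff d k N L ν) p q|
      = ‖((DeltaA (side k L j) (Mlev d k N L j) 1)⁻¹
          * (fdiff (fine (side k L j) (Mlev d k N L j)) (side k L j : ℂ) μ)ᴴ
          * (fdiff (fine (side k L j) (Mlev d k N L j)) (side k L j : ℂ) ν)ᴴ) (eF d k N L j p.1, p.2) (eF d k N L j q.1, q.2)‖ := by
  rw [norm_DeltaA_inv_fdiffH_fdiffH_apply, mul_colDiff_apply, mul_colDiff_apply, mul_colDiff_apply]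
  simp only [gFlat]
  simp only [SliceFlatStencil.eF_add, SliceFlatStencil.eF_single]
  have hs : (0 : ℝ) ≤ (side k L j : ℝ) ^ 2 := by positivity
  rw [← abs_of_nonneg hs, ← abs_mul, abs_of_nonneg hs]
  congr 1
  ring

/-! ## §2 Transport, instance-level and allowance-agnostic: per-cube rows on the flat carrier ⇒ per-block row sums on Bałaban's torus -/

/-- **SECOND DIFFERENCES `∇_μ∇_νΔ_1⁻¹`, PER-BLOCK ROW SUMS FROM PER-CUBE FLAT ROWS** — for fixed `(k, N, L, j, μ, ν)` and ANY reals `A`,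
`δ ≥ 0`: if on the NE3 carrier `Σ_{q : cubeI j q = y₁} |rowDiff μ (rowDiff ν (gFlat j)) p q| ≤ A·e^{−δ·nbd_j(cubeI j p, y₁)}` for all
`p, y₁`, then on Bałaban's fine torus `Tor (fine (side k L j) (Mlev d k N L j))` (`side k L j` sites per block side), for every row `i`
and every block `y′`, `Σ_{x′ : blockOf x′ = y′} ‖(∇_μ·∇_ν·Δ_1⁻¹)(i,x′)‖ ≤ A·e^{−δ·|blockOf(i) − y′|_{T₁,∞}}`.  The allowance of the
second-order letters (a `log`, a small power, …) lives inside `A`; nothing here depends on it. [folklore] -/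
theorem block_row_sum_fdiff_fdiff_inv_le {A δ : ℝ} (hδ : 0 ≤ δ) (j : ℕ) (μ ν : Fin (d + 1))
    (hrow : ∀ (p : TPt (d + 1) (N * L ^ k) × Fin (d + 1)) (y₁ : TPt (d + 1) (levM k N L j)),
      ∑ q ∈ Finset.univ.filter (fun q => cubeI (d + 1) k N L (Fin (d + 1)) j q = y₁),
          |rowDiff d k N L μ (rowDiff d k N L ν (gFlat d k N L j)) p q|
        ≤ A * Real.exp (-(δ * nbd (d + 1) k N L j (cubeI (d + 1) k N L (Fin (d + 1)) j p) y₁)))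
    (i : Tor (fine (side k L j) (Mlev d k N L j)) × Fin (d + 1)) (y' : TPt (d + 1) (levM k N L j)) :
    ∑ x' : Tor (fine (side k L j) (Mlev d k N L j)) × Fin (d + 1),
        (if blockOf (side k L j) (Mlev d k N L j) x'.1 = y' then
          ‖(fdiff (fine (side k L j) (Mlev d k N L j)) (side k L j : ℂ) μ
            * fdiff (fine (side k L j) (Mlev d k N L j)) (side k L j : ℂ) ν
            * (DeltaA (side k L j) (Mlev d k N L j) 1)⁻¹) i x'‖
         else 0)
      ≤ A * Real.exp (-(δ * torusSupNorm (Mlev d k N L j)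
          (rep (Mlev d k N L j) (blockOf (side k L j) (Mlev d k N L j) i.1) - rep (Mlev d k N L j) y'))) := by
  -- the row, pulled back along `eF`
  obtain ⟨p, rfl⟩ : ∃ p : TPt (d + 1) (N * L ^ k) × Fin (d + 1), i = (eF d k N L j p.1, p.2) :=
    ⟨((eF d k N L j).symm i.1, i.2), by simp⟩
  set G := fdiff (fine (side k L j) (Mlev d k N L j)) (side k L j : ℂ) μ
    * fdiff (fine (side k L j) (Mlev d k N L j)) (side k L j : ℂ) ν
    * (DeltaA (side k L j) (Mlev d k N L j) 1)⁻¹ with hG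
  have hblk : blockOf (side k L j) (Mlev d k N L j) (eF d k N L j p.1, p.2).1 = cubeI (d + 1) k N L (Fin (d + 1)) j p :=
    blockOf_eF d k N L j p.1
  -- the constant is nonnegative (the row statement at this very instance)
  have hA : 0 ≤ A := by
    have h := (Finset.sum_nonneg fun q _ => abs_nonneg _).trans (hrow p y')
    have hpos : 0 < Real.exp (-(δ * nbd (d + 1) k N L j (cubeI (d + 1) k N L (Fin (d + 1)) j p) y')) := Real.exp_pos _
    exact (mul_nonneg_iff_of_pos_right hpos).mp h
  -- (1) reindex the block sum along `eF × id`
  have step1 : ∑ x' : Tor (fine (side k L j) (Mlev d k N L j)) × Fin (d + 1),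
        (if blockOf (side k L j) (Mlev d k N L j) x'.1 = y' then ‖G (eF d k N L j p.1, p.2) x'‖ else 0)
      = ∑ q : TPt (d + 1) (N * L ^ k) × Fin (d + 1),
        (if cubeI (d + 1) k N L (Fin (d + 1)) j q = y' then ‖G (eF d k N L j p.1, p.2) (eF d k N L j q.1, q.2)‖ else 0) := by
    refine (Fintype.sum_equiv ((eF d k N L j).prodCongr (Equiv.refl _)) _ _ fun q => ?_).symm
    obtain ⟨z, μ'⟩ := q
    simp only [Equiv.prodCongr_apply, Equiv.coe_refl, Prod.map_apply, id_eq]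
    rw [blockOf_eF]
    rfl
  -- (2) the summands ARE NE3's double row differences (no power of `n`)
  have step2 : ∑ q : TPt (d + 1) (N * L ^ k) × Fin (d + 1),
        (if cubeI (d + 1) k N L (Fin (d + 1)) j q = y' then ‖G (eF d k N L j p.1, p.2) (eF d k N L j q.1, q.2)‖ else 0)
      = ∑ q ∈ Finset.univ.filter (fun q => cubeI (d + 1) k N L (Fin (d + 1)) j q = y'),
          |rowDiff d k N L μ (rowDiff d k N L ν (gFlat d k N L j)) p q| := by
    rw [Finset.sum_filter]
    refine Finset.sum_congr rfl fun q _ => ?_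
    split_ifs
    · rw [abs_rowDiff_rowDiff_gFlat_eq, ← hG]
    · rfl
  -- (3) the flat bound and the distance dictionary
  rw [step1, step2]
  have hT := torusSupNorm_rep_sub_rep_le_nbd d k N L j (cubeI (d + 1) k N L (Fin (d + 1)) j p) y'
  calc ∑ q ∈ Finset.univ.filter (fun q => cubeI (d + 1) k N L (Fin (d + 1)) j q = y'),
          |rowDiff d k N L μ (rowDiff d k N L ν (gFlat d k N L j)) p q|
      ≤ A * Real.exp (-(δ * nbd (d + 1) k N L j (cubeI (d + 1) k N L (Fin (d + 1)) j p) y')) := hrow p y'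
    _ ≤ A * Real.exp (-(δ * torusSupNorm (Mlev d k N L j)
          (rep (Mlev d k N L j) (blockOf (side k L j) (Mlev d k N L j) (eF d k N L j p.1, p.2).1)
            - rep (Mlev d k N L j) y'))) := by
        rw [hblk]
        exact mul_le_mul_of_nonneg_left (Real.exp_le_exp.mpr (neg_le_neg (mul_le_mul_of_nonneg_left hT hδ))) hA

/-- **THE OPERATOR FORM `Δ_1⁻¹∇_μ^*∇_ν^*`, PER-BLOCK ROW SUMS FROM PER-CUBE FLAT ROWS** — for fixed `(k, N, L, j, μ, ν)` and ANY reals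
`A`, `δ ≥ 0`: if `Σ_{q : cubeI j q = y₁} |(gFlat j·colDiff μ·colDiff ν)(p,q)| ≤ A·e^{−δ·nbd_j(cubeI j p, y₁)}` for all `p, y₁`, then for
every row `i` and every block `y′` of Bałaban's fine torus, `Σ_{x′ : blockOf x′ = y′} ‖(Δ_1⁻¹·∇_μ^*·∇_ν^*)(i,x′)‖ ≤ A·e^{−δ·|blockOf(i) − y′|_{T₁,∞}}`
— the row sums of the requester's `‖G∇^*∇^*‖_{∞→∞}` letter, block by block. [folklore] -/
theorem block_row_sum_inv_fdiffH_fdiffH_le {A δ : ℝ} (hδ : 0 ≤ δ) (j : ℕ) (μ ν : Fin (d + 1))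
    (hcol : ∀ (p : TPt (d + 1) (N * L ^ k) × Fin (d + 1)) (y₁ : TPt (d + 1) (levM k N L j)),
      ∑ q ∈ Finset.univ.filter (fun q => cubeI (d + 1) k N L (Fin (d + 1)) j q = y₁),
          |(gFlat d k N L j * colDiff d k N L μ * colDiff d k N L ν) p q|
        ≤ A * Real.exp (-(δ * nbd (d + 1) k N L j (cubeI (d + 1) k N L (Fin (d + 1)) j p) y₁)))
    (i : Tor (fine (side k L j) (Mlev d k N L j)) × Fin (d + 1)) (y' : TPt (d + 1) (levM k N L j)) :
    ∑ x' : Tor (fine (side k L j) (Mlev d k N L j)) × Fin (d + 1),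
        (if blockOf (side k L j) (Mlev d k N L j) x'.1 = y' then
          ‖((DeltaA (side k L j) (Mlev d k N L j) 1)⁻¹
            * (fdiff (fine (side k L j) (Mlev d k N L j)) (side k L j : ℂ) μ)ᴴ
            * (fdiff (fine (side k L j) (Mlev d k N L j)) (side k L j : ℂ) ν)ᴴ) i x'‖
         else 0)
      ≤ A * Real.exp (-(δ * torusSupNorm (Mlev d k N L j)
          (rep (Mlev d k N L j) (blockOf (side k L j) (Mlev d k N L j) i.1) - rep (Mlev d k N L j) y'))) := by
  obtain ⟨p, rfl⟩ : ∃ p : TPt (d + 1) (N * L ^ k) × Fin (d + 1), i = (eF d k N L j p.1, p.2) :=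
    ⟨((eF d k N L j).symm i.1, i.2), by simp⟩
  set G := (DeltaA (side k L j) (Mlev d k N L j) 1)⁻¹
    * (fdiff (fine (side k L j) (Mlev d k N L j)) (side k L j : ℂ) μ)ᴴ
    * (fdiff (fine (side k L j) (Mlev d k N L j)) (side k L j : ℂ) ν)ᴴ with hG
  have hblk : blockOf (side k L j) (Mlev d k N L j) (eF d k N L j p.1, p.2).1 = cubeI (d + 1) k N L (Fin (d + 1)) j p :=
    blockOf_eF d k N L j p.1
  have hA : 0 ≤ A := by
    have h := (Finset.sum_nonneg fun q _ => abs_nonneg _).trans (hcol p y')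
    have hpos : 0 < Real.exp (-(δ * nbd (d + 1) k N L j (cubeI (d + 1) k N L (Fin (d + 1)) j p) y')) := Real.exp_pos _
    exact (mul_nonneg_iff_of_pos_right hpos).mp h
  have step1 : ∑ x' : Tor (fine (side k L j) (Mlev d k N L j)) × Fin (d + 1),
        (if blockOf (side k L j) (Mlev d k N L j) x'.1 = y' then ‖G (eF d k N L j p.1, p.2) x'‖ else 0)
      = ∑ q : TPt (d + 1) (N * L ^ k) × Fin (d + 1),
        (if cubeI (d + 1) k N L (Fin (d + 1)) j q = y' then ‖G (eF d k N L j p.1, p.2) (eF d k N L j q.1, q.2)‖ else 0) := by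
    refine (Fintype.sum_equiv ((eF d k N L j).prodCongr (Equiv.refl _)) _ _ fun q => ?_).symm
    obtain ⟨z, μ'⟩ := q
    simp only [Equiv.prodCongr_apply, Equiv.coe_refl, Prod.map_apply, id_eq]
    rw [blockOf_eF]
    rfl
  have step2 : ∑ q : TPt (d + 1) (N * L ^ k) × Fin (d + 1),
        (if cubeI (d + 1) k N L (Fin (d + 1)) j q = y' then ‖G (eF d k N L j p.1, p.2) (eF d k N L j q.1, q.2)‖ else 0)
      = ∑ q ∈ Finset.univ.filter (fun q => cubeI (d + 1) k N L (Fin (d + 1)) j q = y'),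
          |(gFlat d k N L j * colDiff d k N L μ * colDiff d k N L ν) p q| := by
    rw [Finset.sum_filter]
    refine Finset.sum_congr rfl fun q _ => ?_
    split_ifs
    · rw [abs_gFlat_mul_colDiff_colDiff_eq, ← hG]
    · rfl
  rw [step1, step2]
  have hT := torusSupNorm_rep_sub_rep_le_nbd d k N L j (cubeI (d + 1) k N L (Fin (d + 1)) j p) y'
  calc ∑ q ∈ Finset.univ.filter (fun q => cubeI (d + 1) k N L (Fin (d + 1)) j q = y'),
          |(gFlat d k N L j * colDiff d k N L μ * colDiff d k N L ν) p q|
      ≤ A * Real.exp (-(δ * nbd (d + 1) k N L j (cubeI (d + 1) k N L (Fin (d + 1)) j p) y')) := hcol p y'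
    _ ≤ A * Real.exp (-(δ * torusSupNorm (Mlev d k N L j)
          (rep (Mlev d k N L j) (blockOf (side k L j) (Mlev d k N L j) (eF d k N L j p.1, p.2).1)
            - rep (Mlev d k N L j) y'))) := by
        rw [hblk]
        exact mul_le_mul_of_nonneg_left (Real.exp_le_exp.mpr (neg_le_neg (mul_le_mul_of_nonneg_left hT hδ))) hA

end Flat

/-! ## §3 The cubic corollaries, CONDITIONAL on the flat ENDs' announced shape (`(1 + log L^j)` allowance) -/

/-- **SECOND DIFFERENCES `∇_μ∇_νΔ_1⁻¹`, `U = 1`, `a = 1`, PER-BLOCK ROW SUMS WITH A `(1 + log n)` ALLOWANCE ON EVERY CUBIC UNIT TORUS —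
CONDITIONAL ON THE FLAT SECOND-ORDER ROWS** (hypothesis `hflat` = the shape announced by the flat suppliers, journal l.28719 ∕ l.28735:
`∃ B₂ δ > 0, ∀ k N L, j ≤ k, μ ν p y₁, Σ_{q : cubeI j q = y₁} |rowDiff μ (rowDiff ν (gFlat j)) p q| ≤ B₂·(1 + log L^j)·e^{−δ·nbd}` — NOT proved
here): for EVERY `n ≥ 1` and EVERY cubic unit torus `Π_μ ℤ/N₀`, all `μ ν`, every row `i` and block `y′`,
`Σ_{x′ : blockOf x′ = y′} ‖(∇_μ·∇_ν·Δ_1⁻¹)(i,x′)‖ ≤ B₂·(1 + log n)·e^{−δ·|blockOf i − y′|_{T₁,∞}}` — §2 at `(k,N,L,j) = (1,N₀,n,1)`. [folklore] -/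
theorem block_row_sum_fdiff_fdiff_inv_le_cubic_of_flat
    (hflat : ∃ B₂ δ : ℝ, 0 < B₂ ∧ 0 < δ ∧ ∀ (k N L : ℕ) [NeZero N] [NeZero L] (j : ℕ), j ≤ k →
      ∀ (μ ν : Fin (d + 1)) (p : TPt (d + 1) (N * L ^ k) × Fin (d + 1)) (y₁ : TPt (d + 1) (levM k N L j)),
        ∑ q ∈ Finset.univ.filter (fun q => cubeI (d + 1) k N L (Fin (d + 1)) j q = y₁),
            |rowDiff d k N L μ (rowDiff d k N L ν (gFlat d k N L j)) p q|
          ≤ B₂ * (1 + Real.log ((L : ℝ) ^ j))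
            * Real.exp (-(δ * nbd (d + 1) k N L j (cubeI (d + 1) k N L (Fin (d + 1)) j p) y₁))) :
    ∃ B δ : ℝ, 0 < B ∧ 0 < δ ∧ ∀ (n N₀ : ℕ) [NeZero n] [NeZero N₀] (μ ν : Fin (d + 1))
      (i : Tor (fine n (fun _ : Fin (d + 1) => N₀)) × Fin (d + 1)) (y' : Tor (fun _ : Fin (d + 1) => N₀)),
        ∑ x' : Tor (fine n (fun _ : Fin (d + 1) => N₀)) × Fin (d + 1),
            (if blockOf n (fun _ : Fin (d + 1) => N₀) x'.1 = y' then
              ‖(fdiff (fine n (fun _ : Fin (d + 1) => N₀)) (n : ℂ) μ * fdiff (fine n (fun _ : Fin (d + 1) => N₀)) (n : ℂ) ν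
                * (DeltaA n (fun _ : Fin (d + 1) => N₀) 1)⁻¹) i x'‖
             else 0)
          ≤ B * (1 + Real.log n) * Real.exp (-(δ * torusSupNorm (fun _ : Fin (d + 1) => N₀)
              (rep (fun _ : Fin (d + 1) => N₀) (blockOf n (fun _ : Fin (d + 1) => N₀) i.1)
                - rep (fun _ : Fin (d + 1) => N₀) y'))) := by
  obtain ⟨B₂, δ, hB, hδ, hrow⟩ := hflat
  refine ⟨B₂, δ, hB, hδ, fun n N₀ _ _ μ ν i y' => ?_⟩
  have key : ∀ (n' : ℕ) (M' : Fin (d + 1) → ℕ), n' = side 1 n 1 → M' = Mlev d 1 N₀ n 1 →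
      ∀ [NeZero n'] [∀ μ, NeZero (M' μ)] (i : Tor (fine n' M') × Fin (d + 1)) (y' : Tor M'),
        ∑ x' : Tor (fine n' M') × Fin (d + 1),
            (if blockOf n' M' x'.1 = y' then
              ‖(fdiff (fine n' M') (n' : ℂ) μ * fdiff (fine n' M') (n' : ℂ) ν * (DeltaA n' M' 1)⁻¹) i x'‖ else 0)
          ≤ B₂ * (1 + Real.log n) * Real.exp (-(δ * torusSupNorm M' (rep M' (blockOf n' M' i.1) - rep M' y'))) := by
    intro n' M' hn' hM'
    subst hn' hM'
    intro _ _ i y'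
    have h := block_row_sum_fdiff_fdiff_inv_le d 1 N₀ n hδ.le 1 μ ν
      (A := B₂ * (1 + Real.log n)) (fun p y₁ => by simpa only [pow_one] using hrow 1 N₀ n 1 le_rfl μ ν p y₁) i y'
    exact h
  exact key n (fun _ => N₀) (by simp [side]) (by funext μ; simp [Mlev, levM]) i y'

/-- **THE OPERATOR FORM `Δ_1⁻¹∇_μ^*∇_ν^*`, `U = 1`, `a = 1`, PER-BLOCK ROW SUMS WITH A `(1 + log n)` ALLOWANCE ON EVERY CUBIC UNIT TORUS
— CONDITIONAL ON THE FLAT OPERATOR-FORM ROWS** (hypothesis = the suppliers' announced operator-form END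
`∃ B₂ δ > 0, ∀ k N L, j ≤ k, μ ν p y₁, Σ_{q : cubeI j q = y₁} |(gFlat j·colDiff μ·colDiff ν)(p,q)| ≤ B₂·(1 + log L^j)·e^{−δ·nbd}` — NOT
proved here): for EVERY `n ≥ 1`, EVERY cubic unit torus, all `μ ν i y′`,
`Σ_{x′ : blockOf x′ = y′} ‖(Δ_1⁻¹·∇_μ^*·∇_ν^*)(i,x′)‖ ≤ B₂·(1 + log n)·e^{−δ·|blockOf i − y′|_{T₁,∞}}`. [folklore] -/
theorem block_row_sum_inv_fdiffH_fdiffH_le_cubic_of_flat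
    (hflat : ∃ B₂ δ : ℝ, 0 < B₂ ∧ 0 < δ ∧ ∀ (k N L : ℕ) [NeZero N] [NeZero L] (j : ℕ), j ≤ k →
      ∀ (μ ν : Fin (d + 1)) (p : TPt (d + 1) (N * L ^ k) × Fin (d + 1)) (y₁ : TPt (d + 1) (levM k N L j)),
        ∑ q ∈ Finset.univ.filter (fun q => cubeI (d + 1) k N L (Fin (d + 1)) j q = y₁),
            |(gFlat d k N L j * colDiff d k N L μ * colDiff d k N L ν) p q|
          ≤ B₂ * (1 + Real.log ((L : ℝ) ^ j))
            * Real.exp (-(δ * nbd (d + 1) k N L j (cubeI (d + 1) k N L (Fin (d + 1)) j p) y₁))) :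
    ∃ B δ : ℝ, 0 < B ∧ 0 < δ ∧ ∀ (n N₀ : ℕ) [NeZero n] [NeZero N₀] (μ ν : Fin (d + 1))
      (i : Tor (fine n (fun _ : Fin (d + 1) => N₀)) × Fin (d + 1)) (y' : Tor (fun _ : Fin (d + 1) => N₀)),
        ∑ x' : Tor (fine n (fun _ : Fin (d + 1) => N₀)) × Fin (d + 1),
            (if blockOf n (fun _ : Fin (d + 1) => N₀) x'.1 = y' then
              ‖((DeltaA n (fun _ : Fin (d + 1) => N₀) 1)⁻¹ * (fdiff (fine n (fun _ : Fin (d + 1) => N₀)) (n : ℂ) μ)ᴴ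
                * (fdiff (fine n (fun _ : Fin (d + 1) => N₀)) (n : ℂ) ν)ᴴ) i x'‖
             else 0)
          ≤ B * (1 + Real.log n) * Real.exp (-(δ * torusSupNorm (fun _ : Fin (d + 1) => N₀)
              (rep (fun _ : Fin (d + 1) => N₀) (blockOf n (fun _ : Fin (d + 1) => N₀) i.1)
                - rep (fun _ : Fin (d + 1) => N₀) y'))) := by
  obtain ⟨B₂, δ, hB, hδ, hcol⟩ := hflat
  refine ⟨B₂, δ, hB, hδ, fun n N₀ _ _ μ ν i y' => ?_⟩
  have key : ∀ (n' : ℕ) (M' : Fin (d + 1) → ℕ), n' = side 1 n 1 → M' = Mlev d 1 N₀ n 1 →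
      ∀ [NeZero n'] [∀ μ, NeZero (M' μ)] (i : Tor (fine n' M') × Fin (d + 1)) (y' : Tor M'),
        ∑ x' : Tor (fine n' M') × Fin (d + 1),
            (if blockOf n' M' x'.1 = y' then
              ‖((DeltaA n' M' 1)⁻¹ * (fdiff (fine n' M') (n' : ℂ) μ)ᴴ * (fdiff (fine n' M') (n' : ℂ) ν)ᴴ) i x'‖ else 0)
          ≤ B₂ * (1 + Real.log n) * Real.exp (-(δ * torusSupNorm M' (rep M' (blockOf n' M' i.1) - rep M' y'))) := by
    intro n' M' hn' hM'
    subst hn' hM'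
    intro _ _ i y'
    have h := block_row_sum_inv_fdiffH_fdiffH_le d 1 N₀ n hδ.le 1 μ ν
      (A := B₂ * (1 + Real.log n)) (fun p y₁ => by simpa only [pow_one] using hcol 1 N₀ n 1 le_rfl μ ν p y₁) i y'
    exact h
  exact key n (fun _ => N₀) (by simp [side]) (by funext μ; simp [Mlev, levM]) i y'

end Summit.QuantumFields.BalabanUV.Beta.GAN24.SndDiffRowSumTransport

end
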